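import Mathlib.AlgebraicGeometry.Morphisms.ClosedImmersion
import Mathlib.AlgebraicGeometry.IdealSheaf.Subscheme
import Mathlib.RingTheory.GradedAlgebra.Homogeneous.Ideal
import Literature.AlgebraicGeometry.Resolution.CobordantBlowupGlobal
import Summits.ResolutionOfSingularities.ResolutionOfSingularities.Theorems.WeightedInvariantDefs
import HarnessLib

/-!
# Route `WeightedInvariant`, crux `DatumToEmbedded` — the chart data of the quotient step

Route `ResolutionOfSingularities/WeightedInvariant`, crux `DatumToEmbedded`
(stmt-ResolutionOfSingularities-0572), line `Sketch` (lead a2, 2026-08-16), stub `stub_qs_atlas`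
(the graded atlas of rank `j + 1` on the cobordant blow-up): the bookkeeping of ONE chart of the
new atlas, posited as a structure so that the ambient half (the chart `D(β t^{Dg})` of
`B₊ = R'.plus` over an old ambient chart `W a`, its `ℤʲ⁺¹`-grading, the unit `η = β t^{Dg}`) and
the quotient half (the principal chart of the blow-up downstairs, the identity
`X' ∩ D(β t^{Dg}) = q'⁻¹(chart)`) can be proved by different hands and assembled.

* `tInvOn R' W'` — the section `t⁻¹|_{W'}` of `B₊` over an open `W'`
  (Włodarczyk's `s = t⁻¹`, arXiv:2203.03090 Rem. 2.3.10; the tree's coordinate `R'.toA1`).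
* `AmbientChart j f i q 𝒜 J R' Dg a β` — for a graded atlas `𝒜` of rank `j`, a family of ideal
  sheaves `J` (the centre's pieces), a Rees filtration `R'` (the centre's), a degree `Dg`, a chart
  index `a` and a degree-`0` section `β ∈ J_Dg(W a)`: an affine open `W'` of `R'.plus` over `W a`
  with a `ℤʲ⁺¹`-grading of its sections (constants in degree `0`, the strict transform's ideal
  homogeneous, `π♯` graded, `t⁻¹` of degree `(0,−1)`), a homogeneous unit `η` of degree `(0, Dg)`
  with `η · (t⁻¹)^{Dg} = π♯ β` such that `W'` is exactly the locus over `W a` where `π♯ β` is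
  `(t⁻¹)^{Dg}` times a unit, and the description of the degree-`(0,0)` sections as the
  `x t^{Dg l} / (β t^{Dg})^l`, `x ∈ J_{Dg l}(W a)` of degree `0` (Włodarczyk §2.3.3: the chart
  `D(x'ᵢ)` of `B₊` and its invariants).

One lemma: `stub_qs_tInvOn_map` (restriction of `t⁻¹|_W` to `W' ⊆ W` is `t⁻¹|_{W'}`), registered
as a sub-goal of `stub_qs_atlas`. [cite: Wlodarczyk2022, §2.3.3 and Rem. 2.3.10]
-/

noncomputable section

open CategoryTheory AlgebraicGeometry TopologicalSpace
open Literature.AlgebraicGeometry.Resolution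

set_option linter.dupNamespace false -- mandated namespace of this single-conjunct summit

namespace Summit.ResolutionOfSingularities.ResolutionOfSingularities.Theorems

/-- The section `t⁻¹|_{W'}` of the cobordant blow-up `B₊ = R'.plus` over an open `W'`: the
pull-back of the coordinate `x` of `𝔸¹ = Spec ℤ[x]` along `B₊ ⊆ B → 𝔸¹` (`R'.toA1`, "x ↦ t⁻¹").
[cite: Wlodarczyk2022, Rem. 2.3.10] -/
def tInvOn {Y : Scheme.{0}}
    (R' : ReesFiltration Y) (W' : (R'.plus : Scheme.{0}).Opens) : Γ((R'.plus : Scheme.{0}), W') :=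
  (R'.plus.ι ≫ R'.toA1).appLE ⊤ W' le_top
    ((Scheme.ΓSpecIso (CommRingCat.of (Polynomial ReesFiltration.ZZ.{0}))).inv Polynomial.X)

/-- **One chart of the rank-`j+1` atlas on the cobordant blow-up, ambient half** (see the module
docstring): the affine open `W' = D(β t^{Dg}) ∩ π₊⁻¹(W a)` of `B₊`, its `ℤʲ⁺¹`-grading, the unit
`η = β t^{Dg}` of degree `(0, Dg)` with `η (t⁻¹)^{Dg} = π♯β`, the characterisation of `W'` as the
locus over `W a` where `π♯β ∈ (t⁻¹)^{Dg} · (unit)`, and the degree-`(0,0)` sections.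
[cite: Wlodarczyk2022, §2.3.3] -/
structure AmbientChart (j : ℕ) {k : Type} [Field k] {Y X V : Scheme.{0}}
    (f : Y ⟶ Spec (.of k)) (i : X ⟶ Y) [IsClosedImmersion i] (q : X ⟶ V)
    (𝒜 : GradedAtlas j f i q) (J : ℕ → Y.IdealSheafData) (R' : ReesFiltration Y) (Dg : ℕ)
    (a : 𝒜.ι) (β : Γ(Y, 𝒜.W a)) : Type 1 where
  /-- the chart, an affine open of `B₊` -/
  W' : (R'.plus : Scheme.{0}).affineOpens
  /-- it lies over the old ambient chart -/
  le_preimage : (W' : (R'.plus : Scheme.{0}).Opens) ≤ R'.πPlus ⁻¹ᵁ (𝒜.W a : Y.Opens)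
  /-- the `ℤʲ⁺¹`-grading of its sections (characters of `𝔾ₘʲ⁺¹`) -/
  piece : (Fin (j + 1) → ℤ) → AddSubgroup Γ((R'.plus : Scheme.{0}), W')
  /-- it is a grading -/
  gradedRing : GradedRing piece
  /-- the unit `η = β t^{Dg}` -/
  η : Γ((R'.plus : Scheme.{0}), W')
  /-- `η` is a unit on the chart -/
  isUnit_η : IsUnit η
  /-- `η` has degree `(0, Dg)` -/
  η_mem : η ∈ piece (Fin.snoc (α := fun _ => ℤ) 0 (Dg : ℤ))
  /-- `t⁻¹` has degree `(0, -1)` -/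
  tInvOn_mem : tInvOn R' W' ∈ piece (Fin.snoc (α := fun _ => ℤ) 0 (-1))
  /-- `η · (t⁻¹)^{Dg} = π♯ β` -/
  η_mul : η * tInvOn R' W' ^ Dg = R'.πPlus.appLE (𝒜.W a) W' le_preimage β
  /-- `π♯` is graded: old degree `χ` becomes `(χ, 0)` -/
  appLE_mem : ∀ (χ : Fin j → ℤ) (s : Γ(Y, 𝒜.W a)), s ∈ 𝒜.piece a χ →
    R'.πPlus.appLE (𝒜.W a) W' le_preimage s ∈ piece (Fin.snoc (α := fun _ => ℤ) χ 0)
  /-- constants have degree `0` -/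
  const_mem : ∀ c : Γ(Spec (.of k), ⊤), (R'.πPlus ≫ f).appLE ⊤ W' le_top c ∈ piece 0
  /-- the ideal of the strict transform of `X` is homogeneous -/
  isHomogeneous : @Ideal.IsHomogeneous (Fin (j + 1) → ℤ)
    (AddSubgroup Γ((R'.plus : Scheme.{0}), W')) Γ((R'.plus : Scheme.{0}), W') _ _ _ piece _ _
    gradedRing ((R'.strictTransformPlus i.ker).ideal W')
  /-- `W'` is exactly the locus over `W a` where `π♯ β` is `(t⁻¹)^{Dg}` times a unit -/
  mem_iff : ∀ y' : (R'.plus : Scheme.{0}), y' ∈ (W' : (R'.plus : Scheme.{0}).Opens) ↔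
    ∃ (O : (R'.plus : Scheme.{0}).affineOpens)
      (hO : (O : (R'.plus : Scheme.{0}).Opens) ≤ R'.πPlus ⁻¹ᵁ (𝒜.W a : Y.Opens)),
      y' ∈ (O : (R'.plus : Scheme.{0}).Opens) ∧ ∃ η₀ : Γ((R'.plus : Scheme.{0}), O),
        IsUnit η₀ ∧ η₀ * tInvOn R' O ^ Dg = R'.πPlus.appLE (𝒜.W a) O hO β
  /-- every degree-`(0,0)` section is some `x t^{Dg l} / η^l`, `x ∈ J_{Dg l}(W a)` of degree `0` -/
  exists_of_mem_zero : ∀ s ∈ piece 0, ∃ (l : ℕ) (x : Γ(Y, 𝒜.W a)),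
    x ∈ (J (Dg * l)).ideal (𝒜.W a) ∧ x ∈ 𝒜.piece a 0 ∧
      s * η ^ l * tInvOn R' W' ^ (Dg * l) = R'.πPlus.appLE (𝒜.W a) W' le_preimage x
  /-- … and conversely -/
  exists_mem_zero : ∀ (l : ℕ) (x : Γ(Y, 𝒜.W a)), x ∈ (J (Dg * l)).ideal (𝒜.W a) →
    x ∈ 𝒜.piece a 0 → ∃ s ∈ piece 0,
      s * η ^ l * tInvOn R' W' ^ (Dg * l) = R'.πPlus.appLE (𝒜.W a) W' le_preimage x

/-- **`t⁻¹` restricts to `t⁻¹`**: for opens `W' ⊆ W` of `B₊`, the restriction of `tInvOn R' W` to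
`W'` is `tInvOn R' W'` (sub-goal `stub_qs_tInvOn_map` of `stub_qs_atlas`). [folklore] -/
theorem stub_qs_tInvOn_map :
    ∀ {Y : Scheme.{0}} (R' : ReesFiltration Y) {W W' : (R'.plus : Scheme.{0}).Opens} (h : W' ≤ W),
      (R'.plus : Scheme.{0}).presheaf.map (homOfLE h).op (tInvOn R' W) = tInvOn R' W' := by
  intro Y R' W W' h
  change ((R'.plus.ι ≫ R'.toA1).appLE ⊤ W le_top ≫
    (R'.plus : Scheme.{0}).presheaf.map (homOfLE h).op) _ = _
  rw [Scheme.Hom.appLE_map]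
  rfl

end Summit.ResolutionOfSingularities.ResolutionOfSingularities.Theorems

end
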